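/-
Copyright (c) 2026 the pub-hodgecm-mathlib formalisation cell (harness21).  Prover seat hodgecm-mathlib-LH1-p01 (g11): LH4 price-list item (P2c) «generic MÖBIUS-shift level
lemma, dyadic twin» (dealer LH4-plan (g6) WORD #50), 2026-09-02.  Over ★ `MatrixMoebiusShiftLevel` (F0P2-p02 (g11), p846642) and ★ `MatrixMoebiusShiftLevelGeneric`.
-/
import Literature.NumberTheory.Automorphic.MatrixMoebiusShiftLevelGeneric   -- ★ `shift_parameter_facts_of_valued_lt_one` (`|c ± 1| = 1`), the `|2| = 1` heads this file generalises
import HarnessLib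

/-!
# The Cayley shift near the identity WITHOUT `|2| = 1`: a level-`(j+1)` element shifts to a level-`j` element as soon as `|c|^j < |2|`
# (Kottwitz 1986 §3; Rogawski 1990 §4.9; O'Meara §63 for the dyadic bookkeeping)

Topic `NumberTheory/Automorphic`; namespace `Literature.NumberTheory.Automorphic.MoebiusShift` (= ★ `MatrixMoebiusShiftLevel{,Generic}`'s).  THEOREMS ONLY (no definition, no
instance, no notation, no named fact, no `sorry`); kernel lane `--supports stmt-HodgeConjecture-24833`, count-neutral.  Cell `pub/hodgecm-mathlib` (D-0151), crux H413 =
`stmt-HodgeConjecture-24833`, half A line LH4, price-list item (P2c) of LH4-plan (g6) WORD #50: the DYADIC TWIN of the Möbius∕Cayley level-shift lemmas ★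
`valued_moebius_sub_one_le_of_level` (`|c| = exp(−1)`, `|2| = 1`) and ★ `valued_moebius_sub_one_le_of_level_of_valued_lt_one` (`0 < |c| < 1`, `|2| = 1`), which the
MÖBIUS-shift consumers of the ramified∕inert type-(2) rows (★ `TypeTwoCayleyShiftBindersCM`, ★ `CayleyShiftOrderDeepCM`, ★ `FinExplicitTransferFactorCayleyShiftRamified`, ★
`LevelTwoLiftInterior`, ★ `UnitaryCarrierCongruenceNhdsBasis`) reach through their `h2 : |2| = 1` binder.  HONEST LABEL: HC_CM is proved only modulo the 7 printed citations (2
remaining named inputs: hLiu418 = stmt-HodgeConjecture-24832, h413 = stmt-HodgeConjecture-24833) until rung 0 closes; count-neutral (pays no organ, opens no road).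

THE MATHEMATICS.  `K` valued in `ℤᵐ⁰`, `0 < |c| < 1` (so `|c ± 1| = 1`), `φ_c(g) = N D⁻¹` with `E := g − 1`, `D = 2c·1 + (c−1)E`, `N = 2c·1 + (c+1)E`, `N − D = 2E`.  The ONLY
use of `|2| = 1` in ★ is the DOMINANCE of `2c·1` in the denominators: `|E| ≤ |c|^{j+1} < |c| = |2c|`.  In general (`2 ≠ 0` forced by the hypothesis): if the entries of `E`
are `≤ r` with `r < |2c|` then `|det D| = |2c|²` and `|(D⁻¹)_{ab}| ≤ |2c|⁻¹` (§1), whence `φ_c(g) − 1 = 2E·D⁻¹` has entries `≤ |2|·|E|·|2c|⁻¹ = |E|∕|c|` — the `|2|`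
CANCELS (§2).  So under the SHARP dominance hypothesis **`|c|^j < |2|`** (⟺ `|c|^{j+1} < |2c|`; at `|c| = exp(−1)`, `|2| = exp(−e)`: `j ≥ e + 1`) a level-`(j+1)` element
`g ≡ 1 (mod c^{j+1})` shifts to level `j`: `φ_c(g) ≡ 1`, `φ_c(g)⁻¹ ≡ 1 (mod c^j)` — one level lost, exactly as at `|2| = 1` (§2, matrix and scalar).  Sharpness: at
`|E| = |2c|` the denominator can vanish (scalar `u = 1 − 2c∕(c−1)` has `(c−1)u + (c+1) = 0`).  §3 is the `exp` dress `|c| = exp(−1)`, `|2| = exp(−e)`, `j ≥ e + 1`.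
READ-BACK: at `|2| = 1` the dominance hypothesis is `|c|^j < 1`, i.e. `j ≥ 1` — ★'s `hj`; the ★ heads are the case `e = 0` (not restated).

## References
* [Kottwitz1986] R. E. Kottwitz, *Base change for unit elements of Hecke algebras*, Compositio Math. 60 (1986), §3.
* [Rogawski1990] J. D. Rogawski, *Automorphic Representations of Unitary Groups in Three Variables*, Ann. of Math. Stud. 123 (1990), §4.9 Prop. 4.9.1 (a)(b) p. 55.
* [Omeara1963] O. T. O'Meara, *Introduction to Quadratic Forms* (1963), §63 (dyadic units: levels relative to `ord 2`).
* [SerreLocalFields1979] J.-P. Serre, *Local Fields*, GTM 67 (1979), Ch. I §§1–2.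
-/

set_option autoImplicit false

noncomputable section

open Matrix
open scoped WithZero

namespace Literature.NumberTheory.Automorphic.MoebiusShift

section Dyadic

variable {K : Type*} [Field K] [Valued K ℤᵐ⁰]

/-! ## §1 The denominator `2c·1 + t·E` when `E` is dominated by `2c`: `|det| = |2c|²`, `|(…)⁻¹_{ab}| ≤ |2c|⁻¹` -/

/-- **The denominator near `1`, no hypothesis on `|2|`**: for `M = 2c·1 + t·E` (`2 × 2`, `|t| ≤ 1`, `|E_{ab}| ≤ r` with `r < |2c|`): `|det M| = |2c|²` and
`|(M⁻¹)_{ab}| ≤ |2c|⁻¹` (adjugate formula; ★ `valued_det_and_inv_two_c_add_of_valued_lt_one` is the case `|2| = 1`, `r = |c|^{j+1}`).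
[cite: Kottwitz1986, §3] [cite: SerreLocalFields1979, Ch. I §§1–2] -/
theorem valued_det_and_inv_two_c_add_of_lt {c t : K} (ht : Valued.v t ≤ 1) {E : Matrix (Fin 2) (Fin 2) K} {r : ℤᵐ⁰}
    (hE : ∀ a b, Valued.v (E a b) ≤ r) (hr : r < Valued.v (2 * c)) :
    Valued.v (((2 * c) • (1 : Matrix (Fin 2) (Fin 2) K) + t • E).det) = Valued.v (2 * c) ^ 2 ∧
      ∀ a b, Valued.v ((((2 * c) • (1 : Matrix (Fin 2) (Fin 2) K) + t • E)⁻¹) a b) ≤ (Valued.v (2 * c))⁻¹ := by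
  set M : Matrix (Fin 2) (Fin 2) K := (2 * c) • (1 : Matrix (Fin 2) (Fin 2) K) + t • E with hM
  set d : ℤᵐ⁰ := Valued.v (2 * c) with hd
  have hdpos : 0 < d := lt_of_le_of_lt zero_le hr
  have hd0 : d ≠ 0 := ne_of_gt hdpos
  have hsmall : ∀ a b, Valued.v (t * E a b) < d := fun a b => by
    rw [map_mul]
    calc Valued.v t * Valued.v (E a b) ≤ 1 * r := mul_le_mul' ht (hE a b)
      _ = r := one_mul _
      _ < d := hr
  have hdiag : ∀ a, Valued.v (M a a) = d := fun a => by
    have e : M a a = 2 * c + t * E a a := by simp [hM, Matrix.add_apply, Matrix.smul_apply, Matrix.one_apply_eq]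
    rw [e, Valuation.map_add_eq_of_lt_left _ (hsmall a a)]
  have hoff : ∀ a b, a ≠ b → Valued.v (M a b) < d := fun a b hab => by
    have e : M a b = t * E a b := by simp [hM, Matrix.add_apply, Matrix.smul_apply, Matrix.one_apply_ne hab]
    rw [e]; exact hsmall a b
  have hall : ∀ a b, Valued.v (M a b) ≤ d := fun a b => by
    by_cases hab : a = b
    · subst hab; exact (hdiag a).le
    · exact (hoff a b hab).le
  -- the determinant
  have hdet : Valued.v M.det = d ^ 2 := by
    rw [Matrix.det_fin_two]
    have hmain : Valued.v (M 0 0 * M 1 1) = d ^ 2 := by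
      rw [map_mul, hdiag, hdiag, pow_two]
    have hsub : Valued.v (M 0 1 * M 1 0) < Valued.v (M 0 0 * M 1 1) := by
      rw [hmain, map_mul, mul_comm, pow_two]
      exact mul_lt_mul_of_le_of_lt_of_nonneg_of_pos (hall 1 0) (hoff 0 1 (by decide)) zero_le hdpos
    rw [Valuation.map_sub_eq_of_lt_left _ hsub, hmain]
  refine ⟨hdet, fun a b => ?_⟩
  have hadj : ∀ a b, Valued.v (M.adjugate a b) ≤ d := fun a b => by
    rw [Matrix.adjugate_fin_two]
    fin_cases a <;> fin_cases b
    · simpa using hall 1 1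
    · simpa using hall 0 1
    · simpa using hall 1 0
    · simpa using hall 0 0
  rw [Matrix.inv_def, Matrix.smul_apply, smul_eq_mul, Ring.inverse_eq_inv', map_mul, map_inv₀, hdet]
  calc (d ^ 2)⁻¹ * Valued.v (M.adjugate a b) ≤ (d ^ 2)⁻¹ * d := mul_le_mul' le_rfl (hadj a b)
    _ = d⁻¹ := by rw [pow_two, mul_inv, mul_assoc, inv_mul_cancel₀ hd0, mul_one]

/-! ## §2 A level-`(j+1)` element shifts to a level-`j` element as soon as `|c|^j < |2|` -/

/-- The dominance hypothesis in the form §1 wants: `|c|^j < |2|`, `c ≠ 0` ⇒ `|c|^{j+1} < |2c|`; and `2 ≠ 0`. [cite: SerreLocalFields1979, Ch. I §§1–2] -/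
theorem pow_succ_lt_valued_two_mul_of_pow_lt {c : K} (hc0 : c ≠ 0) {j : ℕ} (hdom : Valued.v c ^ j < Valued.v (2 : K)) :
    Valued.v c ^ (j + 1) < Valued.v (2 * c) ∧ (2 : K) ≠ 0 := by
  have hvc0 : Valued.v c ≠ 0 := (Valuation.ne_zero_iff _).2 hc0
  refine ⟨?_, fun h => ?_⟩
  · rw [pow_succ, map_mul]
    exact mul_lt_mul_of_pos_right hdom (zero_lt_iff.2 hvc0)
  · rw [h, map_zero] at hdom
    exact not_lt_of_ge zero_le hdom

/-- **A LEVEL-`(j+1)` ELEMENT SHIFTS TO A LEVEL-`j` ELEMENT, NO HYPOTHESIS ON `|2|`** (`2 × 2`; `0 < |c| < 1`): if `|c|^j < |2|` (the sharp dominance condition; at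
`|c| = exp(−1)`, `|2| = exp(−e)` it reads `j ≥ e + 1`) and `g ≡ 1 (mod c^{j+1})` entrywise, then `φ_c(g) − 1 ≡ 0` and `φ_c(g)⁻¹ − 1 ≡ 0 (mod c^j)` entrywise
(`φ_c(g) − 1 = 2(g−1)·D⁻¹`, `|D⁻¹| ≤ |2c|⁻¹`, the `|2|` cancels).  ★ `valued_moebius_sub_one_le_of_level_of_valued_lt_one` is the case `|2| = 1` (`|c|^j < 1 ⟺ j ≥ 1`).
[cite: Kottwitz1986, §3] [cite: Rogawski1990, §4.9 Prop. 4.9.1 (b) p. 55] [cite: Omeara1963, §63] -/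
theorem valued_moebius_sub_one_le_of_level_of_pow_lt_two {c : K} (hc0 : c ≠ 0) (hc1 : Valued.v c < 1)
    (g : Matrix (Fin 2) (Fin 2) K) {j : ℕ} (hdom : Valued.v c ^ j < Valued.v (2 : K)) (hg : ∀ a b, Valued.v ((g - 1) a b) ≤ Valued.v c ^ (j + 1)) :
    (∀ a b, Valued.v ((((c + 1) • g + (c - 1) • (1 : Matrix (Fin 2) (Fin 2) K)) * ((c - 1) • g + (c + 1) • (1 : Matrix (Fin 2) (Fin 2) K))⁻¹ - 1) a b) ≤
        Valued.v c ^ j) ∧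
      ∀ a b, Valued.v (((((c + 1) • g + (c - 1) • (1 : Matrix (Fin 2) (Fin 2) K)) * ((c - 1) • g + (c + 1) • (1 : Matrix (Fin 2) (Fin 2) K))⁻¹)⁻¹ - 1) a b) ≤
        Valued.v c ^ j := by
  obtain ⟨-, -, hcm, hcp, -, -⟩ := shift_parameter_facts_of_valued_lt_one hc0 hc1
  obtain ⟨hr, h20⟩ := pow_succ_lt_valued_two_mul_of_pow_lt hc0 hdom
  have hvc0 : Valued.v c ≠ 0 := (Valuation.ne_zero_iff _).2 hc0
  have hv20 : Valued.v (2 : K) ≠ 0 := (Valuation.ne_zero_iff _).2 h20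
  set E : Matrix (Fin 2) (Fin 2) K := g - 1 with hE
  have hgE : g = 1 + E := by rw [hE, add_sub_cancel]
  -- the two denominators in the `2c·1 + t·E` form
  have hD : (c - 1) • g + (c + 1) • (1 : Matrix (Fin 2) (Fin 2) K) = (2 * c) • (1 : Matrix (Fin 2) (Fin 2) K) + (c - 1) • E := by rw [hgE]; module
  have hN : (c + 1) • g + (c - 1) • (1 : Matrix (Fin 2) (Fin 2) K) = (2 * c) • (1 : Matrix (Fin 2) (Fin 2) K) + (c + 1) • E := by rw [hgE]; module
  obtain ⟨hdetD, hinvD⟩ := valued_det_and_inv_two_c_add_of_lt hcm.le hg hr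
  obtain ⟨hdetN, hinvN⟩ := valued_det_and_inv_two_c_add_of_lt hcp.le hg hr
  rw [hD, hN]
  set D : Matrix (Fin 2) (Fin 2) K := (2 * c) • (1 : Matrix (Fin 2) (Fin 2) K) + (c - 1) • E with hDdef
  set N : Matrix (Fin 2) (Fin 2) K := (2 * c) • (1 : Matrix (Fin 2) (Fin 2) K) + (c + 1) • E with hNdef
  have h2c0 : Valued.v (2 * c) ≠ 0 := by rw [map_mul]; exact mul_ne_zero hv20 hvc0
  have hpow0 : Valued.v (2 * c) ^ 2 ≠ 0 := pow_ne_zero _ h2c0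
  have hDu : IsUnit D.det := isUnit_iff_ne_zero.2 fun h => by rw [h, map_zero] at hdetD; exact hpow0 hdetD.symm
  have hNu : IsUnit N.det := isUnit_iff_ne_zero.2 fun h => by rw [h, map_zero] at hdetN; exact hpow0 hdetN.symm
  have hNsubD : N - D = (2 : K) • E := by rw [hNdef, hDdef]; module
  -- entry bound for `(2•E) * M⁻¹`: the `|2|` cancels against `|2c|⁻¹`
  have hbound : ∀ {Mi : Matrix (Fin 2) (Fin 2) K}, (∀ a b, Valued.v (Mi a b) ≤ (Valued.v (2 * c))⁻¹) →
      ∀ a b, Valued.v ((((2 : K) • E) * Mi) a b) ≤ Valued.v c ^ j := by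
    intro Mi hMi a b
    rw [Matrix.mul_apply]
    refine Valuation.map_sum_le _ fun k _ => ?_
    rw [Matrix.smul_apply, smul_eq_mul, map_mul, map_mul]
    calc Valued.v (2 : K) * Valued.v (E a k) * Valued.v (Mi k b)
        ≤ Valued.v (2 : K) * Valued.v c ^ (j + 1) * (Valued.v (2 * c))⁻¹ := mul_le_mul' (mul_le_mul' le_rfl (hg a k)) (hMi k b)
      _ = Valued.v c ^ j := by
          rw [map_mul, mul_inv, pow_succ]
          field_simp
  refine ⟨fun a b => ?_, fun a b => ?_⟩
  · -- `φ(g) − 1 = (N − D) D⁻¹`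
    have e : N * D⁻¹ - 1 = ((2 : K) • E) * D⁻¹ := by
      rw [← hNsubD, sub_mul, Matrix.mul_nonsing_inv D hDu]
    rw [e]
    exact hbound hinvD a b
  · -- `φ(g)⁻¹ − 1 = (D − N) N⁻¹`
    have e : (N * D⁻¹)⁻¹ - 1 = -(((2 : K) • E) * N⁻¹) := by
      rw [Matrix.mul_inv_rev, Matrix.nonsing_inv_nonsing_inv D hDu, ← hNsubD, ← neg_mul, neg_sub, sub_mul, Matrix.mul_nonsing_inv N hNu]
    rw [e, Matrix.neg_apply, Valuation.map_neg]
    exact hbound hinvN a b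

/-- **The scalar denominators, no hypothesis on `|2|`**: `|u − 1| ≤ |c|^{j+1}`, `|c|^j < |2|`, `0 < |c| < 1` ⇒ `|(c−1)u + (c+1)| = |2c|` and `|(c+1)u + (c−1)| = |2c|`
(in particular both are non-zero). [cite: Kottwitz1986, §3] [cite: SerreLocalFields1979, Ch. I §§1–2] -/
theorem valued_scalar_shift_denominators_of_pow_lt_two {c : K} (hc0 : c ≠ 0) (hc1 : Valued.v c < 1)
    (u : K) {j : ℕ} (hdom : Valued.v c ^ j < Valued.v (2 : K)) (hu : Valued.v (u - 1) ≤ Valued.v c ^ (j + 1)) :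
    Valued.v ((c - 1) * u + (c + 1)) = Valued.v (2 * c) ∧ Valued.v ((c + 1) * u + (c - 1)) = Valued.v (2 * c) := by
  obtain ⟨-, -, hcm, hcp, -, -⟩ := shift_parameter_facts_of_valued_lt_one hc0 hc1
  obtain ⟨hr, -⟩ := pow_succ_lt_valued_two_mul_of_pow_lt hc0 hdom
  have hsmall : ∀ {t : K}, Valued.v t = 1 → Valued.v (t * (u - 1)) < Valued.v (2 * c) := fun {t} ht => by
    rw [map_mul, ht, one_mul]
    exact hu.trans_lt hr
  have eD : (c - 1) * u + (c + 1) = 2 * c + (c - 1) * (u - 1) := by ring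
  have eN : (c + 1) * u + (c - 1) = 2 * c + (c + 1) * (u - 1) := by ring
  refine ⟨?_, ?_⟩
  · rw [eD, Valuation.map_add_eq_of_lt_left _ (hsmall hcm)]
  · rw [eN, Valuation.map_add_eq_of_lt_left _ (hsmall hcp)]

/-- **The scalar twin, no hypothesis on `|2|`**: `|u − 1| ≤ |c|^{j+1}`, `|c|^j < |2|`, `0 < |c| < 1` ⇒ `φ_c(u) − 1 ≡ 0` and `φ_c(u)⁻¹ − 1 ≡ 0 (mod c^j)`,
`φ_c(u) = ((c+1)u + (c−1))∕((c−1)u + (c+1))` (★ `valued_moebius_scalar_sub_one_le_of_level_of_valued_lt_one` is the case `|2| = 1`). [cite: Kottwitz1986, §3] [cite: Omeara1963, §63] -/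
theorem valued_moebius_scalar_sub_one_le_of_level_of_pow_lt_two {c : K} (hc0 : c ≠ 0) (hc1 : Valued.v c < 1)
    (u : K) {j : ℕ} (hdom : Valued.v c ^ j < Valued.v (2 : K)) (hu : Valued.v (u - 1) ≤ Valued.v c ^ (j + 1)) :
    Valued.v (((c + 1) * u + (c - 1)) / ((c - 1) * u + (c + 1)) - 1) ≤ Valued.v c ^ j ∧
      Valued.v ((((c + 1) * u + (c - 1)) / ((c - 1) * u + (c + 1)))⁻¹ - 1) ≤ Valued.v c ^ j := by
  have hvc0 : Valued.v c ≠ 0 := (Valuation.ne_zero_iff _).2 hc0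
  obtain ⟨-, h20⟩ := pow_succ_lt_valued_two_mul_of_pow_lt hc0 hdom
  have hv20 : Valued.v (2 : K) ≠ 0 := (Valuation.ne_zero_iff _).2 h20
  have h2c0 : Valued.v (2 * c) ≠ 0 := by rw [map_mul]; exact mul_ne_zero hv20 hvc0
  obtain ⟨hD, hN⟩ := valued_scalar_shift_denominators_of_pow_lt_two hc0 hc1 u hdom hu
  have hD0 : (c - 1) * u + (c + 1) ≠ 0 := fun h => by rw [h, map_zero] at hD; exact h2c0 hD.symm
  have hN0 : (c + 1) * u + (c - 1) ≠ 0 := fun h => by rw [h, map_zero] at hN; exact h2c0 hN.symm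
  have hfin : ∀ {d : K}, Valued.v d = Valued.v (2 * c) → Valued.v (2 * (u - 1) / d) ≤ Valued.v c ^ j := fun {d} hd => by
    rw [map_div₀, map_mul, hd, div_eq_mul_inv]
    calc Valued.v (2 : K) * Valued.v (u - 1) * (Valued.v (2 * c))⁻¹
        ≤ Valued.v (2 : K) * Valued.v c ^ (j + 1) * (Valued.v (2 * c))⁻¹ := mul_le_mul' (mul_le_mul' le_rfl hu) le_rfl
      _ = Valued.v c ^ j := by
          rw [map_mul, mul_inv, pow_succ]
          field_simp
  refine ⟨?_, ?_⟩
  · have e : ((c + 1) * u + (c - 1)) / ((c - 1) * u + (c + 1)) - 1 = 2 * (u - 1) / ((c - 1) * u + (c + 1)) := by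
      rw [div_sub_one hD0]; congr 1; ring
    rw [e]; exact hfin hD
  · have e : (((c + 1) * u + (c - 1)) / ((c - 1) * u + (c + 1)))⁻¹ - 1 = -(2 * (u - 1) / ((c + 1) * u + (c - 1))) := by
      rw [inv_div, div_sub_one hN0, ← neg_div]; congr 1; ring
    rw [e, Valuation.map_neg]; exact hfin hN

/-! ## §3 The `exp` dress: `|c| = exp(−1)`, `|2| = exp(−e)`, `j ≥ e + 1` -/

/-- The dominance hypothesis at `|c| = exp(−1)`, `|2| = exp(−e)`: `j ≥ e + 1 ⇒ |c|^j < |2|`. [cite: SerreLocalFields1979, Ch. I §§1–2] -/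
theorem pow_lt_valued_two_of_exp {c : K} (hc : Valued.v c = WithZero.exp (-1 : ℤ)) {e : ℕ} (he : Valued.v (2 : K) = WithZero.exp (-(e : ℤ)))
    {j : ℕ} (hj : e + 1 ≤ j) : Valued.v c ^ j < Valued.v (2 : K) := by
  rw [valued_pow_of_valued_eq_exp_neg_one hc, he, WithZero.exp_lt_exp]
  omega

/-- **DYADIC LEVEL SHIFT, `exp` dress** (`2 × 2`): with `|c| = exp(−1)` and `|2| = exp(−e)` (`e = ord 2`), a level-`(j+1)` element `g ≡ 1 (mod c^{j+1})` with `j ≥ e + 1` shifts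
to a level-`j` element: `φ_c(g) − 1 ≡ 0`, `φ_c(g)⁻¹ − 1 ≡ 0 (mod c^j)` — one level lost, no more, as at `e = 0` (★ `valued_moebius_sub_one_le_of_level`).
[cite: Kottwitz1986, §3] [cite: Rogawski1990, §4.9 Prop. 4.9.1 (b) p. 55] [cite: Omeara1963, §63] -/
theorem valued_moebius_sub_one_le_of_level_of_exp {c : K} (hc : Valued.v c = WithZero.exp (-1 : ℤ)) {e : ℕ} (he : Valued.v (2 : K) = WithZero.exp (-(e : ℤ)))
    (g : Matrix (Fin 2) (Fin 2) K) {j : ℕ} (hj : e + 1 ≤ j) (hg : ∀ a b, Valued.v ((g - 1) a b) ≤ Valued.v c ^ (j + 1)) :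
    (∀ a b, Valued.v ((((c + 1) • g + (c - 1) • (1 : Matrix (Fin 2) (Fin 2) K)) * ((c - 1) • g + (c + 1) • (1 : Matrix (Fin 2) (Fin 2) K))⁻¹ - 1) a b) ≤
        Valued.v c ^ j) ∧
      ∀ a b, Valued.v (((((c + 1) • g + (c - 1) • (1 : Matrix (Fin 2) (Fin 2) K)) * ((c - 1) • g + (c + 1) • (1 : Matrix (Fin 2) (Fin 2) K))⁻¹)⁻¹ - 1) a b) ≤
        Valued.v c ^ j := by
  have hc0 : c ≠ 0 := fun h => by rw [h, map_zero] at hc; exact WithZero.zero_ne_coe hc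
  have hc1 : Valued.v c < 1 := by rw [hc, ← WithZero.exp_zero, WithZero.exp_lt_exp]; norm_num
  exact valued_moebius_sub_one_le_of_level_of_pow_lt_two hc0 hc1 g (pow_lt_valued_two_of_exp hc he hj) hg

/-- **DYADIC LEVEL SHIFT, scalar, `exp` dress**: `|u − 1| ≤ |c|^{j+1}`, `|c| = exp(−1)`, `|2| = exp(−e)`, `j ≥ e + 1` ⇒ `φ_c(u) − 1 ≡ 0`, `φ_c(u)⁻¹ − 1 ≡ 0 (mod c^j)`.
[cite: Kottwitz1986, §3] [cite: Omeara1963, §63] -/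
theorem valued_moebius_scalar_sub_one_le_of_level_of_exp {c : K} (hc : Valued.v c = WithZero.exp (-1 : ℤ)) {e : ℕ} (he : Valued.v (2 : K) = WithZero.exp (-(e : ℤ)))
    (u : K) {j : ℕ} (hj : e + 1 ≤ j) (hu : Valued.v (u - 1) ≤ Valued.v c ^ (j + 1)) :
    Valued.v (((c + 1) * u + (c - 1)) / ((c - 1) * u + (c + 1)) - 1) ≤ Valued.v c ^ j ∧
      Valued.v ((((c + 1) * u + (c - 1)) / ((c - 1) * u + (c + 1)))⁻¹ - 1) ≤ Valued.v c ^ j := by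
  have hc0 : c ≠ 0 := fun h => by rw [h, map_zero] at hc; exact WithZero.zero_ne_coe hc
  have hc1 : Valued.v c < 1 := by rw [hc, ← WithZero.exp_zero, WithZero.exp_lt_exp]; norm_num
  exact valued_moebius_scalar_sub_one_le_of_level_of_pow_lt_two hc0 hc1 u (pow_lt_valued_two_of_exp hc he hj) hu

end Dyadic

end Literature.NumberTheory.Automorphic.MoebiusShift

end
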